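import Mathlib.Algebra.Order.BigOperators.Group.Finset
import Mathlib.Algebra.BigOperators.Ring.Finset
import Mathlib.Algebra.BigOperators.Intervals
import Mathlib.Data.Real.Basic
import Mathlib.Tactic.Linarith
import Mathlib.Tactic.Ring
import Mathlib.Tactic.Positivity
import Mathlib.Tactic.FieldSimp
import HarnessLib

/-!
# One-step scheme, `(2′)` for sub-block thresholds — the ONE-DIMENSIONAL LEVEL TRANSPORT

Support file (prover prim-ineq-prove-3 gen 20; `--supports stmt-CriticalPhenomena-4575`; memo
`run/shared/lean/prim/prim-ineq-prove-3/FINDING-G20-COUPLING-SPLIT.md` §2 (Step 3, TRANSPORT) and §3).  Pure finite-sum real inequalities.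

The "transport" step of the sub-block threshold theorem, in coupling-free form.  Sources `m` carry masses `α m ≥ 0` and values `s m ≥ 0`,
targets `k` carry masses `β k ≥ 0` and values `τ k ≥ 0`; a source may be compared with a target BELOW it:
`s m · β k ≤ α m · τ k` for `k ≤ m` (hypothesis (i), = LEMMA S≤T of `…SubblockMediant` after summation); the source mass distribution is
stochastically LARGER than the target distribution (CDF form, (ii)); and `α m = 0 → s m = 0` (iii).  Then `Σ s ≤ Σ τ` (equal total masses,
`transport_low_window`), and in homogeneous form `(Σ s)(Σ β) ≤ (Σ α)(Σ τ)` (`transport_low`).  Proof: induction on the window, matching the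
bottom source into the bottom target and merging the residual bottom target upwards (the quantile coupling, unrolled).  The mirror statement
(sources compared with targets ABOVE them, source distribution stochastically SMALLER) is `transport_high_window` / `transport_high`.
-/

namespace Summit.CriticalPhenomena.PercolationContinuityZ3.Theorems

namespace SahiOneStep

open Finset

/-- **Level transport, window form (sources use lower targets).**  On the window `[i, r)`: nonnegative `α, s, β, τ` with
(i) `s m · β k ≤ α m · τ k` for `i ≤ k ≤ m < r`, (ii) `Σ_{[i,x]} α ≤ Σ_{[i,x]} β` for all `x` and equal totals on `[i,r)`, (iii) `α m = 0 → s m = 0`;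
then `Σ_{[i,r)} s ≤ Σ_{[i,r)} τ`. [this work] -/
theorem transport_low_window (n : ℕ) : ∀ (i r : ℕ) (α s β τ : ℕ → ℝ), r = i + n →
    (∀ m, 0 ≤ α m) → (∀ m, 0 ≤ s m) → (∀ k, 0 ≤ β k) → (∀ k, 0 ≤ τ k) →
    (∀ k m, i ≤ k → k ≤ m → m < r → s m * β k ≤ α m * τ k) →
    (∑ m ∈ Ico i r, α m = ∑ k ∈ Ico i r, β k) →
    (∀ x, i ≤ x → x < r → ∑ m ∈ Ico i (x + 1), α m ≤ ∑ k ∈ Ico i (x + 1), β k) →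
    (∀ m, α m = 0 → s m = 0) →
    ∑ m ∈ Ico i r, s m ≤ ∑ k ∈ Ico i r, τ k := by
  induction n with
  | zero =>
    intro i r α s β τ hr _ _ _ _ _ _ _ _
    subst hr
    simp
  | succ n ih =>
    intro i r α s β τ hr hα hs hβ hτ hi hmass hcdf hiii
    have hir : i < r := by omega
    -- the bottom index
    have hα0β0 : α i ≤ β i := by
      have := hcdf i le_rfl hir
      simpa [Finset.sum_Ico_succ_top (le_refl i)] using this
    have hsi : s i * β i ≤ α i * τ i := hi i i le_rfl le_rfl hir
    rw [Finset.sum_eq_sum_Ico_succ_bot hir, Finset.sum_eq_sum_Ico_succ_bot hir]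
    by_cases hβ0 : β i = 0
    · -- then `α i = 0`, `s i = 0`; apply the induction hypothesis to the same data on `[i+1, r)`
      have hα0 : α i = 0 := le_antisymm (hβ0 ▸ hα0β0) (hα i)
      have hs0 : s i = 0 := hiii i hα0
      have key := ih (i + 1) r α s β τ (by omega) hα hs hβ hτ
        (fun k m hk hkm hm => hi k m (by omega) hkm hm)
        (by
          have h1 := hmass
          rw [Finset.sum_eq_sum_Ico_succ_bot hir, Finset.sum_eq_sum_Ico_succ_bot hir, hα0, hβ0] at h1
          linarith)
        (fun x hx hxr => by
          have h1 := hcdf x (by omega) hxr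
          rw [Finset.sum_eq_sum_Ico_succ_bot (show i < x + 1 by omega),
            Finset.sum_eq_sum_Ico_succ_bot (show i < x + 1 by omega), hα0, hβ0] at h1
          linarith)
        hiii
      rw [hs0]
      linarith [hτ i]
    · have hβ0pos : 0 < β i := lt_of_le_of_ne (hβ i) (Ne.symm hβ0)
      -- the share of `τ i` used by the bottom source and the residual share
      set θ : ℝ := (β i - α i) / β i with hθ
      have hθ0 : 0 ≤ θ := div_nonneg (by linarith) hβ0pos.le
      have hs_i : s i ≤ α i / β i * τ i := by
        rw [div_mul_eq_mul_div, le_div_iff₀ hβ0pos]; linarith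
      by_cases hlast : i + 1 = r
      · -- one index: equal masses give `α i = β i`
        have hmass' : α i = β i := by
          have h1 := hmass
          rw [Finset.sum_eq_sum_Ico_succ_bot hir, Finset.sum_eq_sum_Ico_succ_bot hir, ← hlast] at h1
          simpa using h1
        rw [← hlast]
        simp only [Finset.Ico_self, Finset.sum_empty, add_zero]
        calc s i ≤ α i / β i * τ i := hs_i
          _ = τ i := by rw [hmass', div_self hβ0, one_mul]
      · have hir' : i + 1 < r := by omega
        -- merged targets: the residual bottom target joins index `i+1`
        set β' : ℕ → ℝ := fun k => β k + if k = i + 1 then β i - α i else 0 with hβ'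
        set τ' : ℕ → ℝ := fun k => τ k + if k = i + 1 then θ * τ i else 0 with hτ'
        have hβ'nn : ∀ k, 0 ≤ β' k := fun k => by
          simp only [hβ']; split_ifs <;> linarith [hβ k]
        have hτ'nn : ∀ k, 0 ≤ τ' k := fun k => by
          simp only [hτ']; split_ifs
          · exact add_nonneg (hτ k) (mul_nonneg hθ0 (hτ i))
          · linarith [hτ k]
        -- sums of the merged targets over windows starting at `i+1`
        have sumβ' : ∀ y, i + 1 < y → ∑ k ∈ Ico (i + 1) y, β' k = (∑ k ∈ Ico (i + 1) y, β k) + (β i - α i) := by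
          intro y hy
          simp only [hβ', Finset.sum_add_distrib]
          congr 1
          rw [Finset.sum_ite_eq' (Ico (i + 1) y) (i + 1) (fun _ => β i - α i)]
          rw [if_pos (Finset.mem_Ico.2 ⟨le_rfl, hy⟩)]
        have sumτ' : ∑ k ∈ Ico (i + 1) r, τ' k = (∑ k ∈ Ico (i + 1) r, τ k) + θ * τ i := by
          simp only [hτ', Finset.sum_add_distrib]
          congr 1
          rw [Finset.sum_ite_eq' (Ico (i + 1) r) (i + 1) (fun _ => θ * τ i)]
          rw [if_pos (Finset.mem_Ico.2 ⟨le_rfl, hir'⟩)]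
        have key := ih (i + 1) r α s β' τ' (by omega) hα hs hβ'nn hτ'nn
          (fun k m hk hkm hm => by
            simp only [hβ', hτ']
            by_cases hki : k = i + 1
            · rw [if_pos hki, if_pos hki, mul_add, mul_add]
              have h1 := hi k m (by omega) hkm hm
              have h2 := hi i m le_rfl (by omega) hm
              have h3 : s m * (β i - α i) ≤ α m * (θ * τ i) := by
                have e : β i - α i = θ * β i := by rw [hθ]; field_simp
                rw [e]
                calc s m * (θ * β i) = θ * (s m * β i) := by ring
                  _ ≤ θ * (α m * τ i) := mul_le_mul_of_nonneg_left h2 hθ0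
                  _ = α m * (θ * τ i) := by ring
              linarith
            · rw [if_neg hki, if_neg hki, add_zero, add_zero]
              exact hi k m (by omega) hkm hm)
          (by
            rw [sumβ' r hir']
            have h1 := hmass
            rw [Finset.sum_eq_sum_Ico_succ_bot hir, Finset.sum_eq_sum_Ico_succ_bot hir] at h1
            linarith)
          (fun x hx hxr => by
            rw [sumβ' (x + 1) (by omega)]
            have h1 := hcdf x (by omega) hxr
            rw [Finset.sum_eq_sum_Ico_succ_bot (show i < x + 1 by omega),
              Finset.sum_eq_sum_Ico_succ_bot (show i < x + 1 by omega)] at h1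
            linarith)
          hiii
        rw [sumτ'] at key
        have hsplit : α i / β i * τ i + θ * τ i = τ i := by
          rw [hθ]; field_simp; ring
        linarith

/-- **Level transport, homogeneous form (sources use lower targets).**  On `[0, r)`: nonnegative `α, s, β, τ` with (i) `s m · β k ≤ α m · τ k`
for `k ≤ m < r`, (ii) the source distribution is stochastically larger than the target distribution in cross-multiplied CDF form
`(Σ_{m≤x} α)(Σ β) ≤ (Σ_{k≤x} β)(Σ α)`, and (iii) `α m = 0 → s m = 0`; then `(Σ s)(Σ β) ≤ (Σ α)(Σ τ)`. [this work] -/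
theorem transport_low (r : ℕ) (α s β τ : ℕ → ℝ) (hα : ∀ m, 0 ≤ α m) (hs : ∀ m, 0 ≤ s m) (hβ : ∀ k, 0 ≤ β k) (hτ : ∀ k, 0 ≤ τ k)
    (hi : ∀ k m, k ≤ m → m < r → s m * β k ≤ α m * τ k)
    (hcdf : ∀ x, x < r → (∑ m ∈ range (x + 1), α m) * (∑ k ∈ range r, β k) ≤ (∑ k ∈ range (x + 1), β k) * (∑ m ∈ range r, α m))
    (hiii : ∀ m, α m = 0 → s m = 0) :
    (∑ m ∈ range r, s m) * (∑ k ∈ range r, β k) ≤ (∑ m ∈ range r, α m) * (∑ k ∈ range r, τ k) := by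
  set Zα := ∑ m ∈ range r, α m with hZα
  set Zβ := ∑ k ∈ range r, β k with hZβ
  have hZα0 : 0 ≤ Zα := Finset.sum_nonneg fun m _ => hα m
  have hZβ0 : 0 ≤ Zβ := Finset.sum_nonneg fun k _ => hβ k
  have hτsum : 0 ≤ ∑ k ∈ range r, τ k := Finset.sum_nonneg fun k _ => hτ k
  by_cases hZβz : Zβ = 0
  · rw [hZβz, mul_zero]; exact mul_nonneg hZα0 hτsum
  by_cases hZαz : Zα = 0
  · -- all sources vanish
    have hα0 : ∀ m ∈ range r, α m = 0 := fun m hm =>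
      (Finset.sum_eq_zero_iff_of_nonneg (fun m _ => hα m)).1 hZαz m hm
    have hs0 : ∑ m ∈ range r, s m = 0 := Finset.sum_eq_zero fun m hm => hiii m (hα0 m hm)
    rw [hs0, zero_mul, hZαz, zero_mul]
  have hZβpos : 0 < Zβ := lt_of_le_of_ne hZβ0 (Ne.symm hZβz)
  have hZαpos : 0 < Zα := lt_of_le_of_ne hZα0 (Ne.symm hZαz)
  -- rescale the targets to the source mass
  set c : ℝ := Zα / Zβ with hc
  have hc0 : 0 ≤ c := div_nonneg hZα0 hZβ0
  have key := transport_low_window r 0 r α s (fun k => c * β k) (fun k => c * τ k) (by omega) hα hs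
    (fun k => mul_nonneg hc0 (hβ k)) (fun k => mul_nonneg hc0 (hτ k))
    (fun k m _ hkm hm => by
      have := hi k m hkm hm
      calc s m * (c * β k) = c * (s m * β k) := by ring
        _ ≤ c * (α m * τ k) := mul_le_mul_of_nonneg_left this hc0
        _ = α m * (c * τ k) := by ring)
    (by
      rw [Finset.range_eq_Ico] at hZα hZβ
      rw [← Finset.mul_sum, ← hZβ, ← hZα, hc, div_mul_cancel₀ _ hZβz])
    (fun x _ hxr => by
      have h1 := hcdf x hxr
      rw [← Finset.mul_sum, ← Finset.range_eq_Ico]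
      rw [hc, div_mul_eq_mul_div, le_div_iff₀ hZβpos]
      linarith)
    hiii
  rw [← Finset.mul_sum, ← Finset.range_eq_Ico] at key
  -- key : Σ s ≤ c * Σ τ
  calc (∑ m ∈ range r, s m) * Zβ ≤ (c * ∑ k ∈ range r, τ k) * Zβ := mul_le_mul_of_nonneg_right key hZβ0
    _ = Zα * ∑ k ∈ range r, τ k := by rw [hc]; field_simp

/-- **Level transport, window form (sources use higher targets).**  On the window `[i, i+n)`: nonnegative `α, s, β, τ` with
(i) `s m · β k ≤ α m · τ k` for `i ≤ m ≤ k < i+n`, (ii) `Σ_{[x,i+n)} α ≤ Σ_{[x,i+n)} β` for all `x` and equal totals, (iii) `α m = 0 → s m = 0`;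
then `Σ s ≤ Σ τ`. [this work] -/
theorem transport_high_window (n : ℕ) : ∀ (i : ℕ) (α s β τ : ℕ → ℝ),
    (∀ m, 0 ≤ α m) → (∀ m, 0 ≤ s m) → (∀ k, 0 ≤ β k) → (∀ k, 0 ≤ τ k) →
    (∀ m k, i ≤ m → m ≤ k → k < i + n → s m * β k ≤ α m * τ k) →
    (∑ m ∈ Ico i (i + n), α m = ∑ k ∈ Ico i (i + n), β k) →
    (∀ x, i ≤ x → x < i + n → ∑ m ∈ Ico x (i + n), α m ≤ ∑ k ∈ Ico x (i + n), β k) →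
    (∀ m, α m = 0 → s m = 0) →
    ∑ m ∈ Ico i (i + n), s m ≤ ∑ k ∈ Ico i (i + n), τ k := by
  induction n with
  | zero =>
    intro i α s β τ _ _ _ _ _ _ _ _
    simp
  | succ n ih =>
    intro i α s β τ hα hs hβ hτ hi hmass hcdf hiii
    -- the top index `p = i + n`
    set p := i + n with hp
    have htop : i + (n + 1) = p + 1 := by omega
    rw [htop] at hi hmass hcdf ⊢
    have hip : i ≤ p := by omega
    have hαβ : α p ≤ β p := by
      have := hcdf p hip (by omega)
      simpa [Finset.sum_Ico_succ_top (le_refl p)] using this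
    have hsp : s p * β p ≤ α p * τ p := hi p p hip le_rfl (by omega)
    rw [Finset.sum_Ico_succ_top hip, Finset.sum_Ico_succ_top hip]
    by_cases hβ0 : β p = 0
    · have hα0 : α p = 0 := le_antisymm (hβ0 ▸ hαβ) (hα p)
      have hs0 : s p = 0 := hiii p hα0
      have key := ih i α s β τ hα hs hβ hτ
        (fun m k hm hmk hk => hi m k hm hmk (by omega))
        (by
          have h1 := hmass
          rw [Finset.sum_Ico_succ_top hip, Finset.sum_Ico_succ_top hip, hα0, hβ0] at h1
          linarith)
        (fun x hx hxr => by
          have h1 := hcdf x hx (by omega)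
          rw [Finset.sum_Ico_succ_top (show x ≤ p by omega), Finset.sum_Ico_succ_top (show x ≤ p by omega), hα0, hβ0] at h1
          linarith)
        hiii
      rw [hs0]
      linarith [hτ p]
    · have hβ0pos : 0 < β p := lt_of_le_of_ne (hβ p) (Ne.symm hβ0)
      set θ : ℝ := (β p - α p) / β p with hθ
      have hθ0 : 0 ≤ θ := div_nonneg (by linarith) hβ0pos.le
      have hs_p : s p ≤ α p / β p * τ p := by
        rw [div_mul_eq_mul_div, le_div_iff₀ hβ0pos]; linarith
      by_cases hlast : n = 0
      · -- one index
        have hempty : Finset.Ico i p = ∅ := by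
          rw [Finset.Ico_eq_empty_iff]; omega
        have hmass' : α p = β p := by
          have h1 := hmass
          rw [Finset.sum_Ico_succ_top hip, Finset.sum_Ico_succ_top hip, hempty] at h1
          simpa using h1
        rw [hempty]
        simp only [Finset.sum_empty, zero_add]
        calc s p ≤ α p / β p * τ p := hs_p
          _ = τ p := by rw [hmass', div_self hβ0, one_mul]
      · have hip' : i < p := by omega
        -- merged targets: the residual top target joins index `p - 1`
        set β' : ℕ → ℝ := fun k => β k + if k = p - 1 then β p - α p else 0 with hβ'
        set τ' : ℕ → ℝ := fun k => τ k + if k = p - 1 then θ * τ p else 0 with hτ'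
        have hβ'nn : ∀ k, 0 ≤ β' k := fun k => by
          simp only [hβ']; split_ifs <;> linarith [hβ k]
        have hτ'nn : ∀ k, 0 ≤ τ' k := fun k => by
          simp only [hτ']; split_ifs
          · exact add_nonneg (hτ k) (mul_nonneg hθ0 (hτ p))
          · linarith [hτ k]
        have sumβ' : ∀ x, x ≤ p - 1 → ∑ k ∈ Ico x p, β' k = (∑ k ∈ Ico x p, β k) + (β p - α p) := by
          intro x hx
          simp only [hβ', Finset.sum_add_distrib]
          congr 1
          rw [Finset.sum_ite_eq' (Ico x p) (p - 1) (fun _ => β p - α p)]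
          rw [if_pos (Finset.mem_Ico.2 ⟨hx, by omega⟩)]
        have sumτ' : ∑ k ∈ Ico i p, τ' k = (∑ k ∈ Ico i p, τ k) + θ * τ p := by
          simp only [hτ', Finset.sum_add_distrib]
          congr 1
          rw [Finset.sum_ite_eq' (Ico i p) (p - 1) (fun _ => θ * τ p)]
          rw [if_pos (Finset.mem_Ico.2 ⟨by omega, by omega⟩)]
        have key := ih i α s β' τ' hα hs hβ'nn hτ'nn
          (fun m k hm hmk hk => by
            simp only [hβ', hτ']
            by_cases hkp : k = p - 1
            · rw [if_pos hkp, if_pos hkp, mul_add, mul_add]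
              have h1 := hi m k hm hmk (by omega)
              have h2 := hi m p hm (by omega) (by omega)
              have h3 : s m * (β p - α p) ≤ α m * (θ * τ p) := by
                have e : β p - α p = θ * β p := by rw [hθ]; field_simp
                rw [e]
                calc s m * (θ * β p) = θ * (s m * β p) := by ring
                  _ ≤ θ * (α m * τ p) := mul_le_mul_of_nonneg_left h2 hθ0
                  _ = α m * (θ * τ p) := by ring
              linarith
            · rw [if_neg hkp, if_neg hkp, add_zero, add_zero]
              exact hi m k hm hmk (by omega))
          (by
            rw [sumβ' i (by omega)]
            have h1 := hmass
            rw [Finset.sum_Ico_succ_top hip, Finset.sum_Ico_succ_top hip] at h1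
            linarith)
          (fun x hx hxr => by
            rw [sumβ' x (by omega)]
            have h1 := hcdf x hx (by omega)
            rw [Finset.sum_Ico_succ_top (show x ≤ p by omega), Finset.sum_Ico_succ_top (show x ≤ p by omega)] at h1
            linarith)
          hiii
        rw [sumτ'] at key
        have hsplit : α p / β p * τ p + θ * τ p = τ p := by
          rw [hθ]; field_simp; ring
        linarith

/-- **Level transport, homogeneous form (sources use higher targets).**  On the window `[lo, hi)`: nonnegative `α, s, β, τ` with
(i) `s m · β k ≤ α m · τ k` for `lo ≤ m ≤ k < hi`, (ii) the source distribution is stochastically smaller than the target distribution in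
cross-multiplied tail form `(Σ_{[x,hi)} α)(Σ β) ≤ (Σ_{[x,hi)} β)(Σ α)`, (iii) `α m = 0 → s m = 0`; then `(Σ s)(Σ β) ≤ (Σ α)(Σ τ)`. [this work] -/
theorem transport_high (lo up : ℕ) (α s β τ : ℕ → ℝ) (hα : ∀ m, 0 ≤ α m) (hs : ∀ m, 0 ≤ s m) (hβ : ∀ k, 0 ≤ β k) (hτ : ∀ k, 0 ≤ τ k)
    (hcmp : ∀ m k, lo ≤ m → m ≤ k → k < up → s m * β k ≤ α m * τ k)
    (hcdf : ∀ x, lo ≤ x → x < up →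
      (∑ m ∈ Ico x up, α m) * (∑ k ∈ Ico lo up, β k) ≤ (∑ k ∈ Ico x up, β k) * (∑ m ∈ Ico lo up, α m))
    (hiii : ∀ m, α m = 0 → s m = 0) :
    (∑ m ∈ Ico lo up, s m) * (∑ k ∈ Ico lo up, β k) ≤ (∑ m ∈ Ico lo up, α m) * (∑ k ∈ Ico lo up, τ k) := by
  by_cases hlohi : up < lo
  · rw [Finset.Ico_eq_empty_of_le hlohi.le]; simp
  obtain ⟨n, hn⟩ : ∃ n, up = lo + n := ⟨up - lo, by omega⟩
  subst hn
  set Zα := ∑ m ∈ Ico lo (lo + n), α m with hZα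
  set Zβ := ∑ k ∈ Ico lo (lo + n), β k with hZβ
  have hZα0 : 0 ≤ Zα := Finset.sum_nonneg fun m _ => hα m
  have hZβ0 : 0 ≤ Zβ := Finset.sum_nonneg fun k _ => hβ k
  have hτsum : 0 ≤ ∑ k ∈ Ico lo (lo + n), τ k := Finset.sum_nonneg fun k _ => hτ k
  by_cases hZβz : Zβ = 0
  · rw [hZβz, mul_zero]; exact mul_nonneg hZα0 hτsum
  by_cases hZαz : Zα = 0
  · have hα0 : ∀ m ∈ Ico lo (lo + n), α m = 0 := fun m hm =>
      (Finset.sum_eq_zero_iff_of_nonneg (fun m _ => hα m)).1 hZαz m hm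
    have hs0 : ∑ m ∈ Ico lo (lo + n), s m = 0 := Finset.sum_eq_zero fun m hm => hiii m (hα0 m hm)
    rw [hs0, zero_mul, hZαz, zero_mul]
  have hZβpos : 0 < Zβ := lt_of_le_of_ne hZβ0 (Ne.symm hZβz)
  set c : ℝ := Zα / Zβ with hc
  have hc0 : 0 ≤ c := div_nonneg hZα0 hZβ0
  have key := transport_high_window n lo α s (fun k => c * β k) (fun k => c * τ k) hα hs
    (fun k => mul_nonneg hc0 (hβ k)) (fun k => mul_nonneg hc0 (hτ k))
    (fun m k hm hmk hk => by
      have := hcmp m k hm hmk hk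
      calc s m * (c * β k) = c * (s m * β k) := by ring
        _ ≤ c * (α m * τ k) := mul_le_mul_of_nonneg_left this hc0
        _ = α m * (c * τ k) := by ring)
    (by rw [← Finset.mul_sum, ← hZβ, ← hZα, hc, div_mul_cancel₀ _ hZβz])
    (fun x hx hxr => by
      have h1 := hcdf x hx hxr
      rw [← Finset.mul_sum, hc, div_mul_eq_mul_div, le_div_iff₀ hZβpos]
      linarith)
    hiii
  rw [← Finset.mul_sum] at key
  calc (∑ m ∈ Ico lo (lo + n), s m) * Zβ ≤ (c * ∑ k ∈ Ico lo (lo + n), τ k) * Zβ := mul_le_mul_of_nonneg_right key hZβ0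
    _ = Zα * ∑ k ∈ Ico lo (lo + n), τ k := by rw [hc]; field_simp

end SahiOneStep

end Summit.CriticalPhenomena.PercolationContinuityZ3.Theorems
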